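import Literature.NumberTheory.EllipticCurves.PAdicPowerSeriesZeros
import Literature.NumberTheory.EllipticCurves.PAdicBSDMemIwasawaRatProofs
import Literature.NumberTheory.EllipticCurves.Sprung2012.ColemanMapLambdaActionProofs
import Mathlib.RingTheory.RootsOfUnity.AlgebraicallyClosed
import HarnessLib

/-!
# Values at `ζ − 1` (`ζ ∈ μ_{pⁿ}`) determine an element of `Λ ⊗ ℚ_p` modulo `ω_n`
# (the converse of `IsCongrModOmega.eval₂_eq`; proofs only)

Topic `Literature/NumberTheory/EllipticCurves` (generic Iwasawa-algebra calculus; sibling PROOF file of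
`PlusMinusPAdicLFunction.lean` (`IsCongrModOmega`, `IsCongrModOmega.eval₂_eq`: a congruence modulo
`ω_n = (1+T)^{pⁿ} − 1` in `Λ ⊗ ℚ_p` gives equal values at every `ζ − 1`, `ζ^{pⁿ} = 1`, in `ℂ_p`) and of
`PAdicPowerSeriesZeros.lean` (evaluation of `Λ ⊗ ℚ_p` on the open unit disc of `ℂ_p`)). THIS FILE proves
the CONVERSE: if `A, B ∈ Λ = ℤ_p⟦T⟧` and a polynomial `θ ∈ ℚ_p[T]` satisfy `A(ζ − 1)·θ(ζ − 1) = B(ζ − 1)`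
in `ℂ_p` for every `pⁿ`-th root of unity `ζ ∈ ℂ_p`, then `p^m (A·θ − B) ∈ ω_n Λ` for some `m`
(`exists_C_pow_mul_sub_eq_omega_mul_of_forall_eval`), and the `IsCongrModOmega` form
(`isCongrModOmega_of_forall_eval`). Argument (Washington Prop. 7.2 + Lagrange): every element of `Λ`
is a polynomial modulo `ω_n` (tree: `Sprung2012.exists_polynomial_toIwasawa_cyclotomicOmega_dvd_sub`);
a polynomial over `ℚ_p` vanishing at the `pⁿ` distinct points `ζ − 1` (`ℂ_p` is algebraically closed,
Mathlib `PadicComplex.isAlgClosed`, so a primitive `pⁿ`-th root of unity exists) is divisible by the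
monic `ω_n` (remainder of degree `< pⁿ` with `pⁿ` roots); denominators are cleared by a power of `p`.
Consumer: the K3 line `colemanrat` of `BirchSwinnertonDyer` (crux `SignedKatoDivisibilityUpToAtTwo`),
whose published-input stub states the explicit reciprocity law as a congruence
«`ν·P_n(z) ≡ μ·θ_n (mod ω_n)`» while the printed sources (Kato Thm. 12.5, Kobayashi Prop. 8.25–8.26)
give CHARACTER VALUES `ψ(P_n(z))`, `ψ(θ_n)` — this file is the bridge «values ⇒ congruence». HONEST
FRAMING: theorems only (no definition, no named fact, no instance); nothing about any curve is asserted;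
BSD is not proved by any of this.

References: [Washington1997] L. Washington, *Introduction to Cyclotomic Fields*, GTM 83, Prop. 7.2 and
§7.2 (evaluation of `Λ` at `ζ − 1`); [Pollack2003] R. Pollack, Duke Math. J. 118 (2003), proof of
Prop. 6.18 (congruences mod `ω_n^±` ⟺ interpolation at `ζ − 1`); [MazurTateTeitelbaum1986Invent] §I.12.
-/

set_option autoImplicit false

noncomputable section

open scoped Classical

open Polynomial

namespace Literature.NumberTheory.EllipticCurves

variable {p : ℕ} [hp : Fact p.Prime]

/-! ## §1 Polynomial preliminaries over `ℚ_p` -/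

/-- A polynomial over `ℚ_p`, viewed in `ℚ_p⟦T⟧`, lies in `Λ ⊗ ℚ_p`: `p^b · Q = ι(G)` for some `b`
and `G ∈ Λ` (finitely many coefficients are bounded). [cite: MazurTateTeitelbaum1986Invent, §I.12] -/
theorem exists_C_pow_mul_coe_eq_iwasawaToPowerSeries (Q : ℚ_[p][X]) :
    ∃ (b : ℕ) (G : IwasawaAlgebra p),
      PowerSeries.C ((p : ℚ_[p]) ^ b) * (Q : PowerSeries ℚ_[p]) = iwasawaToPowerSeries p G := by
  have hbd : ∀ k : ℕ, ‖PowerSeries.coeff k (Q : PowerSeries ℚ_[p])‖ ≤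
      ∑ i ∈ Q.support, ‖Q.coeff i‖ := by
    intro k
    rw [Polynomial.coeff_coe]
    by_cases hk : k ∈ Q.support
    · exact Finset.single_le_sum (f := fun i ↦ ‖Q.coeff i‖) (fun i _ ↦ norm_nonneg _) hk
    · rw [Polynomial.notMem_support_iff.mp hk, norm_zero]
      exact Finset.sum_nonneg fun i _ ↦ norm_nonneg _
  obtain ⟨b, G, h⟩ := memIwasawaRat_of_forall_norm_coeff_le (p := p) hbd
  exact ⟨b, G, h⟩

/-- `ω_n = (T+1)^{pⁿ} − 1` over `ℚ_p` is monic. [folklore] -/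
private theorem monic_cyclotomicOmega_map_rat (n : ℕ) :
    ((cyclotomicOmega p n).map (algebraMap ℤ ℚ_[p])).Monic :=
  (monic_cyclotomicOmega (p := p) n).map _

/-- `ω_n` has degree `pⁿ` over `ℚ_p`. [folklore] -/
private theorem natDegree_cyclotomicOmega_map_rat (n : ℕ) :
    ((cyclotomicOmega p n).map (algebraMap ℤ ℚ_[p])).natDegree = p ^ n := by
  have hX1 : (X + 1 : ℤ[X]).natDegree = 1 := by
    rw [← Polynomial.C_1, Polynomial.natDegree_X_add_C]
  have hpow : ((X + 1 : ℤ[X]) ^ p ^ n).natDegree = p ^ n := by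
    rw [Polynomial.natDegree_pow, hX1, mul_one]
  rw [Polynomial.natDegree_map_eq_of_injective (algebraMap ℤ ℚ_[p]).injective_int, cyclotomicOmega,
    Polynomial.natDegree_sub_eq_left_of_natDegree_lt, hpow]
  rw [hpow, Polynomial.natDegree_one]
  exact pow_pos hp.out.pos n

omit hp in
/-- `ω_n(ζ − 1) = 0` for `ζ^{pⁿ} = 1` (any commutative ring). [folklore] -/
private theorem eval₂_cyclotomicOmega_eq_zero {S : Type*} [CommRing S] (φ : ℤ →+* S) (n : ℕ) {z : S}
    (hz : (1 + z) ^ p ^ n = 1) : (cyclotomicOmega p n).eval₂ φ z = 0 := by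
  rw [cyclotomicOmega, eval₂_sub, eval₂_pow, eval₂_add, eval₂_X, eval₂_one, add_comm z 1, hz, sub_self]

/-- **Lagrange step**: a polynomial `D ∈ ℚ_p[T]` vanishing at `ζ − 1` for EVERY `pⁿ`-th root of unity
`ζ ∈ ℂ_p` is divisible by `ω_n` in `ℚ_p[T]` (the remainder modulo the monic `ω_n` has degree `< pⁿ` and
`pⁿ` distinct roots `ζ^i − 1`, `ℂ_p` containing a primitive `pⁿ`-th root of unity) — the Lagrange step of «congruence
mod `ω_n` ⟺ interpolation at the `ζ − 1`». [cite: Pollack2003, Prop. 6.18 (proof)] [cite: Washington1997, Prop. 7.2] -/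
theorem cyclotomicOmega_map_dvd_of_forall_eval₂_eq_zero (n : ℕ) {D : ℚ_[p][X]}
    (hD : ∀ z : ℂ_[p], (1 + z) ^ p ^ n = 1 → D.eval₂ (algebraMap ℚ_[p] ℂ_[p]) z = 0) :
    (cyclotomicOmega p n).map (algebraMap ℤ ℚ_[p]) ∣ D := by
  set ω : ℚ_[p][X] := (cyclotomicOmega p n).map (algebraMap ℤ ℚ_[p]) with hω
  have hmonic : ω.Monic := monic_cyclotomicOmega_map_rat n
  -- the remainder modulo `ω_n`
  set R : ℚ_[p][X] := D %ₘ ω with hR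
  suffices hR0 : R = 0 by
    exact (Polynomial.modByMonic_eq_zero_iff_dvd hmonic).mp hR0
  -- a primitive `pⁿ`-th root of unity in `ℂ_p`
  haveI : NeZero ((p : ℕ) : ℂ_[p]) := NeZero.charZero
  obtain ⟨ζ, hζ⟩ := HasEnoughRootsOfUnity.exists_primitiveRoot ℂ_[p] (p ^ n)
  -- `R` vanishes at the `pⁿ` distinct points `ζ^i − 1`
  have hpos : 0 < p ^ n := pow_pos hp.out.pos n
  let f : Fin (p ^ n) → ℂ_[p] := fun i ↦ ζ ^ (i : ℕ) - 1
  have hf : Function.Injective f := by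
    intro i j hij
    have h1 : ζ ^ (i : ℕ) = ζ ^ (j : ℕ) := sub_left_injective hij
    exact Fin.ext (hζ.pow_inj i.isLt j.isLt h1)
  have heval : ∀ i, (R.map (algebraMap ℚ_[p] ℂ_[p])).eval (f i) = 0 := by
    intro i
    have hroot : (1 + f i) ^ p ^ n = 1 := by
      change (1 + (ζ ^ (i : ℕ) - 1)) ^ p ^ n = 1
      rw [add_sub_cancel, ← pow_mul, mul_comm, pow_mul, hζ.pow_eq_one, one_pow]
    have hDω : D = ω * (D /ₘ ω) + R := by rw [hR, add_comm, Polynomial.modByMonic_add_div D ω]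
    have hωz : ω.eval₂ (algebraMap ℚ_[p] ℂ_[p]) (f i) = 0 := by
      rw [hω, Polynomial.eval₂_map]
      have : (algebraMap ℚ_[p] ℂ_[p]).comp (algebraMap ℤ ℚ_[p]) = algebraMap ℤ ℂ_[p] :=
        RingHom.ext_int _ _
      rw [this]
      exact eval₂_cyclotomicOmega_eq_zero _ n hroot
    have h := hD (f i) hroot
    rw [hDω, eval₂_add, eval₂_mul, hωz, zero_mul, zero_add] at h
    rwa [Polynomial.eval_map]
  have hdeg : (R.map (algebraMap ℚ_[p] ℂ_[p])).natDegree < Fintype.card (Fin (p ^ n)) := by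
    rw [Fintype.card_fin]
    refine (Polynomial.natDegree_map_le).trans_lt ?_
    by_cases hR0 : R = 0
    · rw [hR0, Polynomial.natDegree_zero]; exact hpos
    · have h := Polynomial.natDegree_modByMonic_lt D hmonic (by
        intro h1
        have h2 := congrArg Polynomial.natDegree h1
        rw [natDegree_cyclotomicOmega_map_rat, Polynomial.natDegree_one] at h2
        exact absurd h2 hpos.ne')
      rwa [natDegree_cyclotomicOmega_map_rat] at h
  have hmap : R.map (algebraMap ℚ_[p] ℂ_[p]) = 0 :=
    Polynomial.eq_zero_of_natDegree_lt_card_of_eval_eq_zero _ hf heval hdeg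
  exact (Polynomial.map_eq_zero_iff (algebraMap ℚ_[p] ℂ_[p]).injective).mp hmap

/-! ## §2 Evaluation of `Λ` at the `ζ − 1` and the converse of `IsCongrModOmega.eval₂_eq` -/

/-- `‖ζ − 1‖ < 1` for `ζ^{pⁿ} = 1` in `ℂ_p`, phrased for `z = ζ − 1`. [cite: Washington1997, §7.2] -/
theorem norm_lt_one_of_one_add_pow_eq_one {n : ℕ} {z : ℂ_[p]} (hz : (1 + z) ^ p ^ n = 1) : ‖z‖ < 1 := by
  have h := norm_sub_one_lt_one_of_pow_prime_pow_eq_one (p := p) hz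
  rwa [add_sub_cancel_left] at h

/-- **Evaluation at `ζ − 1` only sees `Λ` modulo `ω_n`**: if `ω_n ∣ A − P` in `Λ` (`P ∈ ℤ_p[T]`) and
`(1 + z)^{pⁿ} = 1` in `ℂ_p`, then `A(z) = P(z)` (evaluation on the open unit disc is additive and
multiplicative, `tsum_map_coeff_mul_mul_pow`, and `ω_n(z) = 0`). [cite: Washington1997, Prop. 7.2 and §7.2] -/
theorem tsum_coeff_eq_eval₂_of_omega_dvd_sub {n : ℕ} {A : IwasawaAlgebra p} {P : ℤ_[p][X]}
    (hAP : Sprung2017.toIwasawa p (cyclotomicOmega p n) ∣ A - (P : PowerSeries ℤ_[p])) {z : ℂ_[p]}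
    (hz : (1 + z) ^ p ^ n = 1) :
    ∑' k, ((algebraMap ℚ_[p] ℂ_[p]).comp (algebraMap ℤ_[p] ℚ_[p])) (PowerSeries.coeff k A) * z ^ k =
      P.eval₂ ((algebraMap ℚ_[p] ℂ_[p]).comp (algebraMap ℤ_[p] ℚ_[p])) z := by
  set ιZ : ℤ_[p] →+* ℂ_[p] := (algebraMap ℚ_[p] ℂ_[p]).comp (algebraMap ℤ_[p] ℚ_[p]) with hιZ
  have hz1 : ‖z‖ < 1 := norm_lt_one_of_one_add_pow_eq_one hz
  have hbd : ∀ (G : PowerSeries ℤ_[p]) (k : ℕ), ‖ιZ (PowerSeries.coeff k G)‖ ≤ 1 :=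
    norm_algebraMap_coeff_le_one
  obtain ⟨g, hg⟩ := hAP
  have hA : A = (P : PowerSeries ℤ_[p]) + Sprung2017.toIwasawa p (cyclotomicOmega p n) * g := by
    rw [← hg]; ring
  -- `ω_n(z) = 0`
  have hΩ : ∑' k, ιZ (PowerSeries.coeff k (Sprung2017.toIwasawa p (cyclotomicOmega p n))) * z ^ k = 0 := by
    have h1 := hasSum_map_coeff_coe_mul_pow ιZ ((cyclotomicOmega p n).map (Int.castRingHom ℤ_[p])) z
    rw [Polynomial.eval₂_map, RingHom.ext_int (ιZ.comp (Int.castRingHom ℤ_[p])) (algebraMap ℤ ℂ_[p]),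
      eval₂_cyclotomicOmega_eq_zero _ n hz] at h1
    exact h1.tsum_eq
  -- evaluate `A = P + ω_n g`
  have hsumP : HasSum (fun k ↦ ιZ (PowerSeries.coeff k (P : PowerSeries ℤ_[p])) * z ^ k) (P.eval₂ ιZ z) :=
    hasSum_map_coeff_coe_mul_pow ιZ P z
  have hsumΩg : HasSum (fun k ↦ ιZ (PowerSeries.coeff k
      (Sprung2017.toIwasawa p (cyclotomicOmega p n) * g)) * z ^ k) 0 := by
    have hs := (summable_map_coeff_mul_pow ιZ (hbd _) hz1).hasSum
      (f := fun k ↦ ιZ (PowerSeries.coeff k (Sprung2017.toIwasawa p (cyclotomicOmega p n) * g)) * z ^ k)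
    rwa [tsum_map_coeff_mul_mul_pow ιZ (hbd _) (hbd _) hz1, hΩ, zero_mul] at hs
  have hsum := hsumP.add hsumΩg
  rw [add_zero] at hsum
  have hfun : (fun k ↦ ιZ (PowerSeries.coeff k A) * z ^ k) =
      fun k ↦ ιZ (PowerSeries.coeff k (P : PowerSeries ℤ_[p])) * z ^ k +
        ιZ (PowerSeries.coeff k (Sprung2017.toIwasawa p (cyclotomicOmega p n) * g)) * z ^ k := by
    funext k
    rw [hA, map_add, map_add, add_mul]
  rw [hfun]
  exact hsum.tsum_eq

/-- `ι(C (p^m)) = C (p^m)` for `ι : Λ ↪ ℚ_p⟦T⟧`. [folklore] -/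
private theorem iwasawaToPowerSeries_C_natCast_pow' (m : ℕ) :
    iwasawaToPowerSeries p (PowerSeries.C ((p : ℤ_[p]) ^ m)) = PowerSeries.C ((p : ℚ_[p]) ^ m) := by
  rw [iwasawaToPowerSeries, PowerSeries.map_C, map_pow, map_natCast]

/-- `ι(↑P) = ↑(P.map)` : the inclusion `Λ ↪ ℚ_p⟦T⟧` on polynomials. [folklore] -/
private theorem iwasawaToPowerSeries_coe (P : ℤ_[p][X]) :
    iwasawaToPowerSeries p (P : PowerSeries ℤ_[p]) = ((P.map (algebraMap ℤ_[p] ℚ_[p]) : ℚ_[p][X]) : PowerSeries ℚ_[p]) := by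
  rw [iwasawaToPowerSeries, Polynomial.polynomial_map_coe]

/-- **Values ⇒ congruence (converse of `IsCongrModOmega.eval₂_eq`, with a `Λ`-multiplier).** Let
`A, B ∈ Λ = ℤ_p⟦T⟧` and `θ ∈ ℚ_p[T]`. If `A(ζ − 1)·θ(ζ − 1) = B(ζ − 1)` in `ℂ_p` for every `pⁿ`-th root of
unity `ζ ∈ ℂ_p` (written `z = ζ − 1`, `(1+z)^{pⁿ} = 1`; `A(z) = ∑ ι(a_k) z^k`), then
`p^m · (ι(A)·θ − ι(B)) ∈ ι(ω_n Λ)` for some `m ≥ 0`, i.e. `A·θ ≡ B (mod ω_n)` in `Λ ⊗ ℚ_p`.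
Proof: `A ≡ P_A`, `B ≡ P_B (mod ω_n)` with polynomials (Washington Prop. 7.2), so the values are those
of `P_A θ − P_B ∈ ℚ_p[T]`, which vanishes at the `pⁿ` points `ζ − 1` and is therefore divisible by the
monic `ω_n` (§1); denominators are cleared by a power of `p`. [cite: Washington1997, Prop. 7.2 and §7.2]
[cite: Pollack2003, Prop. 6.18 (proof)] -/
theorem exists_C_pow_mul_sub_eq_omega_mul_of_forall_eval {n : ℕ} (A B : IwasawaAlgebra p) (θ : ℚ_[p][X])
    (h : ∀ z : ℂ_[p], (1 + z) ^ p ^ n = 1 →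
      (∑' k, ((algebraMap ℚ_[p] ℂ_[p]).comp (algebraMap ℤ_[p] ℚ_[p])) (PowerSeries.coeff k A) * z ^ k) *
          θ.eval₂ (algebraMap ℚ_[p] ℂ_[p]) z =
        ∑' k, ((algebraMap ℚ_[p] ℂ_[p]).comp (algebraMap ℤ_[p] ℚ_[p])) (PowerSeries.coeff k B) * z ^ k) :
    ∃ (m : ℕ) (q : IwasawaAlgebra p),
      PowerSeries.C ((p : ℚ_[p]) ^ m) *
          (iwasawaToPowerSeries p A * (θ : PowerSeries ℚ_[p]) - iwasawaToPowerSeries p B) =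
        iwasawaToPowerSeries p (((cyclotomicOmega p n).map (Int.castRingHom ℤ_[p]) : PowerSeries ℤ_[p]) * q) := by
  set ιZ : ℤ_[p] →+* ℂ_[p] := (algebraMap ℚ_[p] ℂ_[p]).comp (algebraMap ℤ_[p] ℚ_[p]) with hιZ
  set Ω : IwasawaAlgebra p := Sprung2017.toIwasawa p (cyclotomicOmega p n) with hΩ
  have hΩcoe : Ω = ((cyclotomicOmega p n).map (Int.castRingHom ℤ_[p]) : PowerSeries ℤ_[p]) := rfl
  -- Step 1: polynomial representatives modulo `ω_n`
  obtain ⟨PA, hPA⟩ := Sprung2012.exists_polynomial_toIwasawa_cyclotomicOmega_dvd_sub p n A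
  obtain ⟨PB, hPB⟩ := Sprung2012.exists_polynomial_toIwasawa_cyclotomicOmega_dvd_sub p n B
  obtain ⟨gA, hgA⟩ := hPA
  obtain ⟨gB, hgB⟩ := hPB
  -- Step 2: the polynomial `D = P_A θ − P_B` vanishes at every `ζ − 1`
  set D : ℚ_[p][X] := PA.map (algebraMap ℤ_[p] ℚ_[p]) * θ - PB.map (algebraMap ℤ_[p] ℚ_[p]) with hD
  have hDz : ∀ z : ℂ_[p], (1 + z) ^ p ^ n = 1 → D.eval₂ (algebraMap ℚ_[p] ℂ_[p]) z = 0 := by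
    intro z hz
    have hAz := tsum_coeff_eq_eval₂_of_omega_dvd_sub ⟨gA, hgA⟩ hz
    have hBz := tsum_coeff_eq_eval₂_of_omega_dvd_sub ⟨gB, hgB⟩ hz
    have hz' := h z hz
    rw [hAz, hBz] at hz'
    rw [hD, eval₂_sub, eval₂_mul, Polynomial.eval₂_map, Polynomial.eval₂_map, hz', sub_self]
  -- Step 3: `ω_n ∣ D` in `ℚ_p[T]`
  obtain ⟨Q, hQ⟩ := cyclotomicOmega_map_dvd_of_forall_eval₂_eq_zero n hDz
  -- Step 4: clear denominators of `θ` and `Q`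
  obtain ⟨a, Θ, hΘ⟩ := exists_C_pow_mul_coe_eq_iwasawaToPowerSeries (p := p) θ
  obtain ⟨b, G, hG⟩ := exists_C_pow_mul_coe_eq_iwasawaToPowerSeries (p := p) Q
  -- Step 5: assemble in `ℚ_p⟦T⟧`
  refine ⟨a + b, PowerSeries.C ((p : ℤ_[p]) ^ b) * gA * Θ + PowerSeries.C ((p : ℤ_[p]) ^ a) * G -
    PowerSeries.C ((p : ℤ_[p]) ^ (a + b)) * gB, ?_⟩
  have hA : A = (PA : PowerSeries ℤ_[p]) + Ω * gA := by rw [← hgA]; ring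
  have hB : B = (PB : PowerSeries ℤ_[p]) + Ω * gB := by rw [← hgB]; ring
  -- the polynomial identity `D = ω_n Q`, read in `ℚ_p⟦T⟧`
  have hDcoe : ((PA.map (algebraMap ℤ_[p] ℚ_[p]) : ℚ_[p][X]) : PowerSeries ℚ_[p]) * (θ : PowerSeries ℚ_[p]) -
      ((PB.map (algebraMap ℤ_[p] ℚ_[p]) : ℚ_[p][X]) : PowerSeries ℚ_[p]) =
        iwasawaToPowerSeries p Ω * (Q : PowerSeries ℚ_[p]) := by
    have h1 := congrArg (fun P : ℚ_[p][X] ↦ (P : PowerSeries ℚ_[p])) hQ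
    simp only [hD, Polynomial.coe_sub, Polynomial.coe_mul] at h1
    rw [h1, hΩcoe, iwasawaToPowerSeries_coe, Polynomial.map_map]
    congr 2
  have hω : iwasawaToPowerSeries p A * (θ : PowerSeries ℚ_[p]) - iwasawaToPowerSeries p B =
      iwasawaToPowerSeries p Ω *
        (iwasawaToPowerSeries p gA * (θ : PowerSeries ℚ_[p]) + (Q : PowerSeries ℚ_[p]) - iwasawaToPowerSeries p gB) := by
    rw [hA, hB]
    simp only [map_add, map_mul, iwasawaToPowerSeries_coe]
    linear_combination hDcoe
  rw [hω]
  simp only [map_mul, map_add, map_sub, iwasawaToPowerSeries_C_natCast_pow', pow_add, ← hΩcoe]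
  linear_combination (iwasawaToPowerSeries p Ω * PowerSeries.C ((p : ℚ_[p]) ^ b) * iwasawaToPowerSeries p gA) * hΘ +
    (iwasawaToPowerSeries p Ω * PowerSeries.C ((p : ℚ_[p]) ^ a)) * hG

/-- **`IsCongrModOmega` from values** (the shape of `PlusMinusPAdicLFunction.IsCongrModOmega`): for
`θ ∈ ℚ[T]`, `ω ∈ ℤ[T]`, `L ∈ Λ`, if `θ(ζ − 1) = ω(ζ − 1)·L(ζ − 1)` in `ℂ_p` for every `pⁿ`-th root of unity
`ζ`, then `θ ≡ ω·L (mod ω_n)` in `Λ ⊗ ℚ_p`. (Converse of `IsCongrModOmega.eval₂_eq`.)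
[cite: Pollack2003, Prop. 6.18 (proof)] [cite: Washington1997, Prop. 7.2] -/
theorem isCongrModOmega_of_forall_eval {n : ℕ} {θ : ℚ[X]} {ω : ℤ[X]} {L : IwasawaAlgebra p}
    (h : ∀ z : ℂ_[p], (1 + z) ^ p ^ n = 1 →
      θ.eval₂ (algebraMap ℚ ℂ_[p]) z =
        ω.eval₂ (algebraMap ℤ ℂ_[p]) z *
          ∑' k, ((algebraMap ℚ_[p] ℂ_[p]).comp (algebraMap ℤ_[p] ℚ_[p])) (PowerSeries.coeff k L) * z ^ k) :
    IsCongrModOmega p n θ ω L := by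
  set ιZ : ℤ_[p] →+* ℂ_[p] := (algebraMap ℚ_[p] ℂ_[p]).comp (algebraMap ℤ_[p] ℚ_[p]) with hιZ
  -- apply the main theorem with `A := 1`, `B := ω · L`, `θ := θ.map`
  have hmain := exists_C_pow_mul_sub_eq_omega_mul_of_forall_eval (n := n) (1 : IwasawaAlgebra p)
    (((ω.map (Int.castRingHom ℤ_[p]) : ℤ_[p][X]) : PowerSeries ℤ_[p]) * L) (θ.map (algebraMap ℚ ℚ_[p])) ?_
  · obtain ⟨m, q, hmq⟩ := hmain
    refine ⟨m, q, ?_⟩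
    rw [map_one, one_mul, Polynomial.polynomial_map_coe] at hmq
    -- `↑(θ.map) ` as power series: `(θ.map f : PowerSeries) = (θ : PowerSeries ℚ).map f`
    rw [Polynomial.polynomial_map_coe]
    exact hmq
  · intro z hz
    have hz1 : ‖z‖ < 1 := norm_lt_one_of_one_add_pow_eq_one hz
    have hbd : ∀ (G : PowerSeries ℤ_[p]) (k : ℕ), ‖ιZ (PowerSeries.coeff k G)‖ ≤ 1 :=
      norm_algebraMap_coeff_le_one
    have h1 : ∑' k, ιZ (PowerSeries.coeff k (1 : IwasawaAlgebra p)) * z ^ k = 1 :=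
      (hasSum_map_coeff_one_mul_pow ιZ z).tsum_eq
    have hω : ∑' k, ιZ (PowerSeries.coeff k (((ω.map (Int.castRingHom ℤ_[p]) : ℤ_[p][X]) : PowerSeries ℤ_[p]) * L)) * z ^ k =
        ω.eval₂ (algebraMap ℤ ℂ_[p]) z * ∑' k, ιZ (PowerSeries.coeff k L) * z ^ k := by
      rw [tsum_map_coeff_mul_mul_pow ιZ (hbd _) (hbd _) hz1,
        (hasSum_map_coeff_coe_mul_pow ιZ _ z).tsum_eq, Polynomial.eval₂_map,
        RingHom.ext_int (ιZ.comp (Int.castRingHom ℤ_[p])) (algebraMap ℤ ℂ_[p])]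
    rw [h1, one_mul, hω, Polynomial.eval₂_map,
      RingHom.ext_rat ((algebraMap ℚ_[p] ℂ_[p]).comp (algebraMap ℚ ℚ_[p])) (algebraMap ℚ ℂ_[p])]
    exact h z hz

end Literature.NumberTheory.EllipticCurves

end
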